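import Mathlib.GroupTheory.FreeGroup.Reduce
import HarnessLib

/-!
# A nonempty word representing `1` in a free group contains an adjacent cancelling pair

Topic `Literature/GroupTheory/CombinatorialGroupTheory`; a small, fully proved complement to
Mathlib's reduction theory of free groups (`Mathlib.GroupTheory.FreeGroup.Basic`,
`FreeGroup.Red`, `FreeGroup.Red.Step`).  Everything here is proved; no definitions, no named
facts.

* `FreeGroup.red_nil_of_mk_eq_one` — a word `L` with `FreeGroup.mk L = 1` reduces to the empty
  word (`Red L []`; Church–Rosser, `FreeGroup.Red.exact`, and `FreeGroup.Red.nil_iff`).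
* `FreeGroup.exists_append_cancel_of_mk_eq_one` — **if `FreeGroup.mk L = 1` and `L ≠ []`, then
  `L = L₁ ++ (x, b) :: (x, !b) :: L₂` for some `L₁, L₂, x, b`**: the first step of a reduction
  of `L` to `[]` exhibits the pair.  Index form: `FreeGroup.exists_getElem_cancel_of_mk_eq_one`
  (some `i` with `L[i] = (x, b)`, `L[i+1] = (x, !b)`).
* `FreeGroup.mk_append_eq_one_of_mk_eq_one` — removing the pair keeps the word trivial and
  shortens it by `2` (`length_lt_of_eq_append_cancel`), the measure for inductions.

## Why this is here (use in 3-manifold topology)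

This is the algebraic half of the *outermost arc / wave* argument for cut systems of a
handlebody (S. Hensel, *A primer on handlebody groups* (2020), §5, proof of Lemma 5.4 and
Cor. 5.11; J. Johnson, *Notes on Heegaard splittings*, Lemma 2.7; H. B. Griffiths,
*Automorphisms of a 3-dimensional handlebody* (1964), §3): a closed curve `c` on the boundary of
a genus-`g` handlebody `V`, transverse to the boundaries `∂D₁, …, ∂D_g` of a complete system of
meridian discs, reads — starting from any point of `c` off the discs — a word `L` in the letters
`(i, ±)` (the signed crossings with `∂Dᵢ`), and `FreeGroup.mk L ∈ F_g ≅ π₁ V` is the class of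
`c`.  If `c` is null-homotopic in `V` and meets the discs at all, the lemma gives two CONSECUTIVE
crossings of the same `∂Dᵢ` with opposite signs, i.e. a sub-arc of `c` leaving `∂Dᵢ` to one
side and returning to `∂Dᵢ` from the same side without meeting any disc in between — a *wave*;
surgery of `Dᵢ` along the wave produces a new meridian system meeting `c` in fewer points.  (The
consecutive letters of the LINEAR word read from an arbitrary starting point are consecutive
along the curve, so no cyclic version is needed.)  This file is a support lemma for the
"Torelli"/meridian-disc half of Griffiths' handlebody extension theorem
(`Literature.Topology.FourManifolds.GriffithsExtension`, `HandlebodyKernelExtensionTorelli.lean`).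

## References

* W. Magnus, A. Karrass, D. Solitar, *Combinatorial Group Theory* (1966), §1.4 (freely reduced
  words, normal form in free groups). [MagnusKarrassSolitar1966]
* S. Hensel, *A primer on handlebody groups*, Handbook of Group Actions V (2020), §5.
  [Hensel2020HandlebodyPrimer]
-/

namespace Literature.GroupTheory.CombinatorialGroupTheory

variable {α : Type*}

/-- A word representing `1` in the free group reduces to the empty word: from
`FreeGroup.mk L = FreeGroup.mk []`, Church–Rosser (`FreeGroup.Red.exact`) gives a common reduct
of `L` and `[]`, and `[]` reduces only to itself (`FreeGroup.Red.nil_iff`).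
[cite: MagnusKarrassSolitar1966, §1.4 (Thm. 1.2, normal form in free groups)] -/
theorem FreeGroup.red_nil_of_mk_eq_one {L : List (α × Bool)} (h : FreeGroup.mk L = 1) :
    FreeGroup.Red L [] := by
  have h' : FreeGroup.mk L = FreeGroup.mk [] := by rw [h, FreeGroup.one_eq_mk]
  obtain ⟨L₃, h₁, h₂⟩ := FreeGroup.Red.exact.1 h'
  rw [FreeGroup.Red.nil_iff] at h₂
  subst h₂
  exact h₁

/-- **A nonempty word representing `1` in a free group contains an adjacent cancelling pair**:
if `FreeGroup.mk L = 1` and `L ≠ []` then `L = L₁ ++ (x, b) :: (x, !b) :: L₂` for some words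
`L₁, L₂`, letter `x` and sign `b` (the first step of a reduction `L →* []`, which exists by
`FreeGroup.red_nil_of_mk_eq_one` and is not the empty reduction because `L ≠ []`).
[cite: MagnusKarrassSolitar1966, §1.4 (Thm. 1.2, normal form in free groups)] -/
theorem FreeGroup.exists_append_cancel_of_mk_eq_one {L : List (α × Bool)}
    (h : FreeGroup.mk L = 1) (hL : L ≠ []) :
    ∃ (L₁ L₂ : List (α × Bool)) (x : α) (b : Bool), L = L₁ ++ (x, b) :: (x, !b) :: L₂ := by
  have hred : Relation.ReflTransGen FreeGroup.Red.Step L [] := FreeGroup.red_nil_of_mk_eq_one h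
  rcases hred.cases_head with he | ⟨L', hstep, -⟩
  · exact absurd he hL
  · rcases hstep with ⟨⟩
    exact ⟨_, _, _, _, rfl⟩

/-- Index form of `FreeGroup.exists_append_cancel_of_mk_eq_one`: a nonempty word representing
`1` has two consecutive letters `L[i] = (x, b)`, `L[i + 1] = (x, !b)`.
[cite: MagnusKarrassSolitar1966, §1.4 (Thm. 1.2, normal form in free groups)] -/
theorem FreeGroup.exists_getElem_cancel_of_mk_eq_one {L : List (α × Bool)}
    (h : FreeGroup.mk L = 1) (hL : L ≠ []) :
    ∃ (i : ℕ) (hi : i + 1 < L.length),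
      (L[i + 1]'hi).1 = (L[i]'(Nat.lt_of_succ_lt hi)).1 ∧
        (L[i + 1]'hi).2 = !(L[i]'(Nat.lt_of_succ_lt hi)).2 := by
  obtain ⟨L₁, L₂, x, b, rfl⟩ := FreeGroup.exists_append_cancel_of_mk_eq_one h hL
  refine ⟨L₁.length, by simp, ?_, ?_⟩
  · simp [List.getElem_append_right]
  · simp [List.getElem_append_right]

/-- Removing an adjacent cancelling pair does not change the element of the free group
(one step of reduction, `FreeGroup.Red.Step.not`). [folklore] -/
theorem FreeGroup.mk_append_cancel_eq (L₁ L₂ : List (α × Bool)) (x : α) (b : Bool) :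
    FreeGroup.mk (L₁ ++ (x, b) :: (x, !b) :: L₂) = FreeGroup.mk (L₁ ++ L₂) :=
  Quot.sound FreeGroup.Red.Step.not

/-- Removing an adjacent cancelling pair from a word representing `1` leaves a word
representing `1`. [folklore] -/
theorem FreeGroup.mk_append_eq_one_of_mk_eq_one {L₁ L₂ : List (α × Bool)} {x : α} {b : Bool}
    (h : FreeGroup.mk (L₁ ++ (x, b) :: (x, !b) :: L₂) = 1) : FreeGroup.mk (L₁ ++ L₂) = 1 := by
  rwa [FreeGroup.mk_append_cancel_eq] at h

/-- Removing an adjacent cancelling pair shortens the word by two letters (the measure that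
decreases in the wave / outermost-arc induction). [folklore] -/
theorem FreeGroup.length_append_lt_of_cancel (L₁ L₂ : List (α × Bool)) (x : α) (b : Bool) :
    (L₁ ++ L₂).length + 2 = (L₁ ++ (x, b) :: (x, !b) :: L₂).length := by
  simp only [List.length_append, List.length_cons]
  omega

/-- **Induction principle behind the wave argument.**  A property of words that holds for the
empty word and passes from `L₁ ++ L₂` to `L₁ ++ (x, b) :: (x, !b) :: L₂` holds for every word
representing `1` in the free group (strong induction on the length, peeling one adjacent
cancelling pair at a time). [folklore] -/
theorem FreeGroup.induction_on_mk_eq_one {P : List (α × Bool) → Prop} (h0 : P [])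
    (hstep : ∀ (L₁ L₂ : List (α × Bool)) (x : α) (b : Bool),
      FreeGroup.mk (L₁ ++ L₂) = 1 → P (L₁ ++ L₂) → P (L₁ ++ (x, b) :: (x, !b) :: L₂))
    {L : List (α × Bool)} (h : FreeGroup.mk L = 1) : P L := by
  induction hn : L.length using Nat.strong_induction_on generalizing L with
  | _ n ih =>
    by_cases hL : L = []
    · subst hL; exact h0
    · obtain ⟨L₁, L₂, x, b, rfl⟩ := FreeGroup.exists_append_cancel_of_mk_eq_one h hL
      have h' : FreeGroup.mk (L₁ ++ L₂) = 1 := FreeGroup.mk_append_eq_one_of_mk_eq_one h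
      have hlt : (L₁ ++ L₂).length < n := by
        rw [← hn, ← FreeGroup.length_append_lt_of_cancel]
        omega
      exact hstep L₁ L₂ x b h' (ih _ hlt h' rfl)

end Literature.GroupTheory.CombinatorialGroupTheory
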